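import Summits.BirchSwinnertonDyer.BirchSwinnertonDyer.Theorems.ManinLocalTwoThreeSemistableTwistTameAtThree
import Literature.NumberTheory.EllipticCurves.FullTwoTorsionConductorExponentProofs
import Literature.NumberTheory.GaloisRepresentations.HeckeCharacterProofs
import Literature.NumberTheory.EllipticCurves.ShortWeierstrassGoodTwistLocalProofs
import Literature.NumberTheory.EllipticCurves.BSDConductor
import Literature.NumberTheory.DiophantineGeometry.ConductorRingOfIntegersProofs
import Literature.NumberTheory.EllipticCurves.RootNumberTwistProofs
import Literature.NumberTheory.EllipticCurves.LFunctionPrimeCoeff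
import HarnessLib

/-!
# `f_p(E) = 2` at an ODD additive prime of quadratic-twist type — `p ≥ 5` always, `p = 3` when `E^{(−3)}` is semistable at `3`
# (route `AdditiveBranchIMC`, crux 19357, LEAD g13; helper of the root-number engine `TwistRootNumberOddThree`)

THEOREMS ONLY. For an elliptic curve `E/ℚ` additive at an odd prime `p`: if `p ≥ 5` then `f_p = 2`
(`conductorExponent_eq_two_of_five_le_holds`, Silverman *ATAEC* IV.10.4); if `p = 3` and the twist `E^{(−3)}` (= `E^{(3*)}`) is not additive at
`3`, then `E` is tame at `3` and `f₃ = 2` (`ManinLocalTwoThree.conductorExponent_eq_two_of_isSemistableAt_quadraticTwist_of_three_mem`, *ATAEC*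
IV.10.2 / IV.11.1), read at the place of `ℤ` under `3` through the `ℤ` / `𝓞 ℚ` / prime-indexed bridges of the tree. [cite: SilvermanATAEC1994, Thm. IV.10.2 and IV.10.4]
-/

set_option linter.dupNamespace false
set_option autoImplicit false

noncomputable section

open scoped Classical

open Literature.NumberTheory.EllipticCurves IsDedekindDomain IsDedekindDomain.HeightOneSpectrum NumberField Rat.HeightOneSpectrum
  WeierstrassCurve Summit.BirchSwinnertonDyer.BirchSwinnertonDyer.Theorems

namespace Summit.BirchSwinnertonDyer.BirchSwinnertonDyer.Theorems.TwistTypeConductor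

/-- **`f_p(E) = 2` at an odd additive prime `p` of quadratic-twist type** (`p ≥ 5`: every additive prime has `f_p = 2`; `p = 3`: the
semistable twist `E^{(−3)}` makes `E` tame at `3`). [cite: SilvermanATAEC1994, Thm. IV.10.2 and IV.10.4] -/
theorem conductorExponent_eq_two_of_twistType_odd (X : WeierstrassCurve ℚ) [X.IsElliptic] (R : Nat.Primes) (hR2 : (R : ℕ) ≠ 2)
    (ha : X.HasAdditiveReductionAt ((primesEquiv (R := ℤ)).symm R))
    (hsemi : (R : ℕ) = 3 → ¬ (X.quadraticTwist (((-1 : ℤ) ^ ((R : ℕ) / 2) * R : ℤ) : ℚ)).HasAdditiveReductionAt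
      ((primesEquiv (R := ℤ)).symm R)) :
    X.conductorExponent ((primesEquiv (R := ℤ)).symm R) = 2 := by
  have natGenerator_symm : ∀ p : Nat.Primes, natGenerator ((primesEquiv (R := ℤ)).symm p) = p :=
    fun p ↦ congrArg (fun q : Nat.Primes ↦ (q : ℕ)) ((primesEquiv (R := ℤ)).apply_symm_apply p)
  by_cases hR5 : 5 ≤ (R : ℕ)
  · exact Literature.NumberTheory.EllipticCurves.conductorExponent_eq_two_of_five_le_holds X
      ((primesEquiv (R := ℤ)).symm R) (by rw [natGenerator_symm]; exact hR5) ha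
  · have hR3 : (R : ℕ) = 3 := by
      have h2le := R.2.two_le
      have hR4 : (R : ℕ) ≠ 4 := fun h4 ↦ by have := R.2; rw [h4] at this; exact absurd this (by norm_num)
      omega
    haveI := Fact.mk R.2
    -- the place of `𝓞 ℚ` over `R = 3`
    set v' : HeightOneSpectrum (𝓞 ℚ) := (primesEquiv (R := 𝓞 ℚ)).symm R with hv'
    have hv'R : primesEquiv v' = R := by rw [hv', Equiv.apply_symm_apply]
    rw [conductorExponent_eq_of_primesEquiv_eq ((primesEquiv (R := ℤ)).symm R) v' X
      (by rw [hv'R, Equiv.apply_symm_apply])]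
    have h3 : (3 : 𝓞 ℚ) ∈ v'.asIdeal := by
      have h : ((3 : ℕ) : 𝓞 ℚ) ∈ v'.asIdeal :=
        (Literature.NumberTheory.GaloisRepresentations.Rat.natCast_mem_asIdeal_iff v').mpr (by rw [hv', natGenerator_primesEquiv_symm_ringOfIntegers, hR3])
      simpa using h
    -- `X` additive at `v'`
    have hng : ¬ X.HasGoodReductionAtPrime (R : ℕ) := fun hg ↦
      ha.not_hasGoodReductionAt ((X.hasGoodReductionAtPrime_iff_hasGoodReductionAt_holds R).mp hg)
    have hnm : ¬ X.HasMultiplicativeReductionAtPrime (R : ℕ) := fun hm ↦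
      ha.not_hasMultiplicativeReductionAt ((X.hasMultiplicativeReductionAtPrime_iff_hasMultiplicativeReductionAt_holds R).mp hm)
    have ha' : X.HasAdditiveReductionAt v' := by
      have h := hasAdditiveReductionAt_ringOfIntegers_of_additive (W := X) (p := (R : ℕ)) hng hnm
      rwa [show (⟨(R : ℕ), (Fact.out : (R : ℕ).Prime)⟩ : Nat.Primes) = R from Subtype.ext rfl] at h
    -- the twist `X^{(R*)}` is semistable at `v'`
    have hrs0Z : ((-1 : ℤ) ^ ((R : ℕ) / 2) * R : ℤ) ≠ 0 :=
      mul_ne_zero (pow_ne_zero _ (by norm_num)) (by exact_mod_cast R.2.ne_zero)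
    have hrs0 : (((-1 : ℤ) ^ ((R : ℕ) / 2) * R : ℤ) : ℚ) ≠ 0 := by exact_mod_cast hrs0Z
    haveI iXR := X.isElliptic_quadraticTwist hrs0
    have hsemi' : (X.quadraticTwist (((-1 : ℤ) ^ ((R : ℕ) / 2) * R : ℤ) : ℚ)).HasGoodReductionAt v' ∨
        (X.quadraticTwist (((-1 : ℤ) ^ ((R : ℕ) / 2) * R : ℤ) : ℚ)).HasMultiplicativeReductionAt v' := by
      rcases hasGoodReductionAt_or_hasMultiplicativeReductionAt_or_hasAdditiveReductionAt
        ((primesEquiv (R := ℤ)).symm R) (X.quadraticTwist (((-1 : ℤ) ^ ((R : ℕ) / 2) * R : ℤ) : ℚ)) with hg | hm | had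
      · left
        have hg' := ((X.quadraticTwist _).hasGoodReductionAtPrime_iff_hasGoodReductionAt_holds R).mpr hg
        have h := (hasGoodReductionAtPrime_iff_hasGoodReductionAt_ringOfIntegers
          (X.quadraticTwist (((-1 : ℤ) ^ ((R : ℕ) / 2) * R : ℤ) : ℚ)) (v := v')).mp
        rw [hv'R] at h
        exact h hg'
      · right
        have hm' := ((X.quadraticTwist _).hasMultiplicativeReductionAtPrime_iff_hasMultiplicativeReductionAt_holds R).mpr hm
        have h := ((X.quadraticTwist (((-1 : ℤ) ^ ((R : ℕ) / 2) * R : ℤ) : ℚ)).hasMultiplicativeReductionAtPrime_iff_hasMultiplicativeReductionAt_ringOfIntegers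
          v').mp
        rw [hv'R] at h
        exact h hm'
      · exact absurd had (hsemi hR3)
    exact ManinLocalTwoThree.conductorExponent_eq_two_of_isSemistableAt_quadraticTwist_of_three_mem X h3 ha' hrs0 hsemi'

end Summit.BirchSwinnertonDyer.BirchSwinnertonDyer.Theorems.TwistTypeConductor

end
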